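/-
Origin: expansion seat `planner-pub-hodgecm-toy-g2-0`, handover #20 2026-08-18T08:36:40Z (`HOME/pub-hodgecm-toy-g2/lean/ToyG2/TopWeight.lean`, md5 5c65e999, 112 lines);
landed by the gen-7 packager in gate run 27 as `HodgeCM/Model/ToyG2/TopWeight.lean` (import ^import ToyG2\.→import HodgeCM.Model.ToyG2. ×1).
-/
/-
# HodgeCM.Model.ToyG2.TopWeight — the weight operator in top degree; `TrType` for block-free objects

Generation 2 of the `pub-hodgecm-toy` lineage (seat `planner-pub-hodgecm-toy-g2-0`), DESIGN.md §9 (G2b′).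

* `Obj.wt_top` : on the top exterior power `⋀^{#Idx}_ℂ H¹(X, ℂ)` the weight operator `wt z` is the scalar
  `z^{#hol}` (every top monomial uses all eigen-indices, half of which are holomorphic);
* `two_mul_dim_eq_finrank` : for a block-free object `2 · dim X = rk H¹(X)`, i.e. its trace lives in
  top degree (`sdeg_eq_card_Idx`);
* **`trType_of_isBlockFree`** : hence `TrType X` (the trace has Hodge type `(dim X, dim X)`) for every
  block-free `X` — the "abelian variety" case of the hypothesis `hT` of `GysinPlan.gysin_of`, with no
  Künneth computation.  Together with `GysinPlan.trType_pbObj` this covers every good surface which is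
  block-free or a single block; the general product case is generation-3 work (DESIGN.md §9 G2b′).
-/
import Mathlib
import Summits.HodgeConjecture.HodgeCM.Model.ToyG2.GysinPlan

namespace HodgeCM.ToyG2

open HodgeCM.Toy HodgeCM.Toy.CMPresentation
open Literature.AlgebraicGeometry.Motives
open scoped TensorProduct
open exteriorPower Obj₂

noncomputable section

/-! ### The weight operator in top degree -/

/-- on `⋀^{#Idx}` the weight operator is the scalar `z^{#hol}` -/
theorem Obj.wt_top (M : Obj) (z : ℂ) {n : ℕ} (hn : Fintype.card M.Idx = n) :
    M.wt z n = (z ^ M.nhol Finset.univ) • LinearMap.id := by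
  refine (M.eB.exteriorPower n).ext fun S => ?_
  have hS : S.val = Finset.univ :=
    Finset.eq_univ_of_card S.val (by rw [hn]; exact S.prop)
  rw [Obj.wt_basis, LinearMap.smul_apply, LinearMap.id_apply, hS]

/-! ### Block-free objects: the trace lives in top degree -/

/-- the index set has `rk_ℚ H¹` elements (`HodgeCM.Toy.Obj.card_Idx` of `StarObj`, re-proved to keep the
import closure small) -/
lemma Obj.card_Idx' (M : Obj) : Fintype.card M.Idx = Module.finrank ℚ M.L := by
  rw [Fintype.card_sigma, Module.finrank_pi_fintype]
  exact Finset.sum_congr rfl fun i _ => NumberField.Embeddings.card ((M.atom i).F) ℂ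

/-- (Ported verbatim from the HodgeCMPerL package; no docstring in the source.) -/
lemma finrank_prod_L (A B : Obj) :
    Module.finrank ℚ (A.prod B).L = Module.finrank ℚ A.L + Module.finrank ℚ B.L := by
  haveI : Module.Free ℚ A.L := Module.Free.of_divisionRing ℚ A.L
  haveI : Module.Free ℚ B.L := Module.Free.of_divisionRing ℚ B.L
  rw [LinearEquiv.finrank_eq (A.sumEquiv B), Module.finrank_prod]

/-- for a non-block leaf (an atom), `2 · pdim = [F:ℚ] = rk H¹` -/
lemma Leaf.two_mul_pdim_eq_finrank : ∀ (lf : Leaf), ¬ lf.IsPB →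
    2 * lf.pdim = Module.finrank ℚ lf.obj.L
  | .atom a, _ => by
      change 2 * (Module.finrank ℚ a.F / 2) = Module.finrank ℚ (Unit → a.F)
      rw [← Atom.two_mul_half a, Module.finrank_pi_fintype, Fintype.sum_unique]
  | .pb p, h => absurd (Leaf.isPB_pb p) h

/-- (Ported verbatim from the HodgeCMPerL package; no docstring in the source.) -/
lemma two_mul_sum_pdim_eq_finrank : ∀ (s : Shape) (l : s.toType → Leaf), (∀ u, ¬ (l u).IsPB) →
    2 * ∑ u, (l u).pdim = Module.finrank ℚ (Obj₂.expand s l).L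
  | .empty, l, _ => by
      simp only [Finset.univ_eq_empty, Finset.sum_empty, mul_zero]
      exact (Module.finrank_zero_of_subsingleton).symm
  | .unit, l, h => by
      rw [Fintype.sum_unique]
      exact Leaf.two_mul_pdim_eq_finrank (l ()) (h ())
  | .sum a b, l, h => by
      rw [Fintype.sum_sum_type, mul_add,
        two_mul_sum_pdim_eq_finrank a (fun u => l (Sum.inl u)) (fun u => h (Sum.inl u)),
        two_mul_sum_pdim_eq_finrank b (fun u => l (Sum.inr u)) (fun u => h (Sum.inr u))]
      exact (finrank_prod_L _ _).symm

/-- for a block-free object, `2 · dim X = rk_ℚ H¹(X)` -/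
theorem two_mul_dim_eq_finrank {X : Obj₂} (h : X.IsBlockFree) :
    2 * X.dim = Module.finrank ℚ X.L :=
  two_mul_sum_pdim_eq_finrank X.s X.leaf h

/-- … so its structural degree is the number of eigen-indices (top degree) -/
theorem sdeg_eq_card_Idx {X : Obj₂} (h : X.IsBlockFree) :
    sdeg X.s X.leaf = Fintype.card X.toObj.Idx := by
  rw [sdeg_eq, two_mul_dim_eq_finrank h, Obj.card_Idx']

/-! ### `TrType` for block-free objects -/

/-- an object whose trace lives in top degree has trace of type `(dim X, dim X)` -/
theorem trType_of_sdeg_eq_card {X : Obj₂} (h : sdeg X.s X.leaf = Fintype.card X.toObj.Idx) :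
    TrType X := by
  intro n z
  by_cases hn : sdeg X.s X.leaf = n
  · have hcard : Fintype.card X.toObj.Idx = n := h ▸ hn
    have hdim : X.toObj.nhol Finset.univ = X.dim := by
      have h2 := two_mul_nhol_univ X.toObj
      rw [← h, sdeg_eq] at h2
      exact Nat.eq_of_mul_eq_mul_left two_pos h2
    rw [Obj.wt_top X.toObj z hcard, hdim, LinearMap.comp_smul, LinearMap.comp_id]
  · rw [trOf_of_ne hn, baseC_zero, LinearMap.zero_comp, smul_zero]

/-- **the trace of a block-free object has Hodge type `(dim X, dim X)`** -/
theorem trType_of_isBlockFree {X : Obj₂} (h : X.IsBlockFree) : TrType X :=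
  trType_of_sdeg_eq_card (sdeg_eq_card_Idx h)

/-- in particular for the CM objects `A_{(K,Φ)}` and their products -/
theorem trType_cmObj₂ (K : CMField) (Φ : CMType K) : TrType (cmObj₂ K Φ) :=
  trType_of_isBlockFree (isBlockFree_cmObj₂ K Φ)

/-- (Ported verbatim from the HodgeCMPerL package; no docstring in the source.) -/
theorem trType_prod_of_isBlockFree {X Y : Obj₂} (hX : X.IsBlockFree) (hY : Y.IsBlockFree) :
    TrType (X.prod Y) :=
  trType_of_isBlockFree (isBlockFree_prod hX hY)

end

end HodgeCM.ToyG2
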